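import Summits.ValiantsHypothesis.ValiantsHypothesis.Theorems.SymPencilPerFourInnerRankTenFamily
import Summits.ValiantsHypothesis.ValiantsHypothesis.Theorems.SymPencilPerFourInnerRankPairs

/-!
# Route `SymPencil` — inner rank of the `2 | 2` row split of `per_4`, VI: all column pairs and
# column types with at most NINE squares (`--supports` stmt-ValiantsHypothesis-5674
# `SdcSuperquadratic`; toward "inner rank `≥ 10`", the cell `(8, 8, 9)` of `m = 26`; rung
# currency only)

The general-index-type version of `SymPencilPerFourInnerRankPairs` (`ι = Fin 8` there): for a
joint family `Σ_{r ∈ ι} c_r t_r(u,y)² = per (a; b; y₂; y₃)` with `c_r ≠ 0` and `|ι| ≤ 9`, the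
family alternative holds for every column pair and both row orders (`family_pair`,
`family_pair'`, by the column / row symmetries `hJ_perm`, `hJ_swap`, `hJ_yswap`), and the
column-type combinatorics forces a PURE factorisation (`allX_or_allY`).  Proofs verbatim from the
`Fin 8` files (whose index-free lemmas `of_rows_comp_perm`, `single_comp_perm`,
`exists_perm_two_three` are reused); the nine-square content is entirely in
`SymPencilPerFourInnerRankKernel.ker_ne_bot_of_radical_pair`.

Honest framing: lemmas; `sdc(per_4) ≥ 25` unchanged; the crux `SdcSuperquadratic` and `VP ≠ VNP`
untouched.  No definitions, no named facts. [folklore]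
-/

noncomputable section

-- single-conjunct layout: Sub = Summit, duplicated namespace component intended
set_option linter.dupNamespace false

namespace Summit.ValiantsHypothesis.ValiantsHypothesis.Theorems.SymPencilPerFourInnerRankTenPairs

open Matrix Finset Module
open Summit.ValiantsHypothesis.ValiantsHypothesis.Theorems.SymPencilPerFourBlocks
open Summit.ValiantsHypothesis.ValiantsHypothesis.Theorems.SymPencilPerFourInnerRankRows
open Summit.ValiantsHypothesis.ValiantsHypothesis.Theorems.SymPencilPerFourInnerRankTenFamily
open Summit.ValiantsHypothesis.ValiantsHypothesis.Theorems.SymPencilPerFourInnerRankPairs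
  (of_rows_comp_perm single_comp_perm exists_perm_two_three)

/-! ### Symmetries of the hypothesis -/

variable {K : Type*} [Field K] {ι : Type*} [Fintype ι]

/-- **Column symmetry**: transporting a joint `8`-square family along a simultaneous column
permutation `π` gives a joint `8`-square family. [folklore] -/
theorem hJ_perm (c : ι → K)
    (t : ι → (((Fin 4 → K) × (Fin 4 → K)) →ₗ[K] ((Fin 4 → K) × (Fin 4 → K)) →ₗ[K] K))
    (hJ : ∀ a b y₂ y₃ : Fin 4 → K,
      ∑ r, c r * (t r (a, b) (y₂, y₃)) ^ 2 = (Matrix.of ![a, b, y₂, y₃]).permanent)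
    (π : Equiv.Perm (Fin 4)) :
    ∀ a b y₂ y₃ : Fin 4 → K,
      ∑ r, c r * ((t r).compl₁₂
        ((LinearEquiv.funCongrLeft K K π).prodCongr (LinearEquiv.funCongrLeft K K π)).toLinearMap
        ((LinearEquiv.funCongrLeft K K π).prodCongr (LinearEquiv.funCongrLeft K K π)).toLinearMap
          (a, b) (y₂, y₃)) ^ 2 = (Matrix.of ![a, b, y₂, y₃]).permanent := by
  intro a b y₂ y₃
  have h := hJ (a ∘ π) (b ∘ π) (y₂ ∘ π) (y₃ ∘ π)
  rw [of_rows_comp_perm, Matrix.permanent_permute_rows] at h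
  exact h

/-- **Row symmetry `a ↔ b`.** [folklore] -/
theorem hJ_swap (c : ι → K)
    (t : ι → (((Fin 4 → K) × (Fin 4 → K)) →ₗ[K] ((Fin 4 → K) × (Fin 4 → K)) →ₗ[K] K))
    (hJ : ∀ a b y₂ y₃ : Fin 4 → K,
      ∑ r, c r * (t r (a, b) (y₂, y₃)) ^ 2 = (Matrix.of ![a, b, y₂, y₃]).permanent) :
    ∀ a b y₂ y₃ : Fin 4 → K,
      ∑ r, c r * ((t r).compl₁₂ (LinearEquiv.prodComm K (Fin 4 → K) (Fin 4 → K)).toLinearMap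
        LinearMap.id (a, b) (y₂, y₃)) ^ 2 = (Matrix.of ![a, b, y₂, y₃]).permanent := by
  intro a b y₂ y₃
  have h := hJ b a y₂ y₃
  rw [per_swap_row₀₁] at h
  exact h

/-- **Row symmetry `y₂ ↔ y₃`.** [folklore] -/
theorem hJ_yswap (c : ι → K)
    (t : ι → (((Fin 4 → K) × (Fin 4 → K)) →ₗ[K] ((Fin 4 → K) × (Fin 4 → K)) →ₗ[K] K))
    (hJ : ∀ a b y₂ y₃ : Fin 4 → K,
      ∑ r, c r * (t r (a, b) (y₂, y₃)) ^ 2 = (Matrix.of ![a, b, y₂, y₃]).permanent) :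
    ∀ a b y₂ y₃ : Fin 4 → K,
      ∑ r, c r * ((t r).compl₂ (LinearEquiv.prodComm K (Fin 4 → K) (Fin 4 → K)).toLinearMap
        (a, b) (y₂, y₃)) ^ 2 = (Matrix.of ![a, b, y₂, y₃]).permanent := by
  intro a b y₂ y₃
  have h := hJ a b y₃ y₂
  rw [per_swap_row₂₃] at h
  exact h

/-! ### The family alternative for every column pair and both row orders -/

/-- **Every column pair `c ≠ d`, base family `b ∈ span(e_c, e_d)`**: either the `a`-parts of the
columns `c, d` of the `y₂`-block vanish (with `n_{cc} = n_{dd} = 0`, `n_{dc} = n_{cd}` for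
`n_{jk} = t((0,e_j),(e_k,0))`), or the same for the `y₃`-block. [folklore] -/
theorem family_pair [CharZero K] [DecidableEq ι] (hι : Fintype.card ι ≤ 9) (c : ι → K)
    (hc : ∀ r, c r ≠ 0)
    (t : ι → (((Fin 4 → K) × (Fin 4 → K)) →ₗ[K] ((Fin 4 → K) × (Fin 4 → K)) →ₗ[K] K))
    (hJ : ∀ a b y₂ y₃ : Fin 4 → K,
      ∑ r, c r * (t r (a, b) (y₂, y₃)) ^ 2 = (Matrix.of ![a, b, y₂, y₃]).permanent)
    (i j : Fin 4) (hij : i ≠ j) :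
    ((∀ (a : Fin 4 → K) r, t r (a, 0) (Pi.single i 1, 0) = 0) ∧
      (∀ (a : Fin 4 → K) r, t r (a, 0) (Pi.single j 1, 0) = 0) ∧
      (∀ r, t r (0, Pi.single i 1) (Pi.single i 1, 0) = 0) ∧
      (∀ r, t r (0, Pi.single j 1) (Pi.single j 1, 0) = 0) ∧
      (∀ r, t r (0, Pi.single j 1) (Pi.single i 1, 0) = t r (0, Pi.single i 1) (Pi.single j 1, 0))) ∨
    ((∀ (a : Fin 4 → K) r, t r (a, 0) (0, Pi.single i 1) = 0) ∧
      (∀ (a : Fin 4 → K) r, t r (a, 0) (0, Pi.single j 1) = 0) ∧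
      (∀ r, t r (0, Pi.single i 1) (0, Pi.single i 1) = 0) ∧
      (∀ r, t r (0, Pi.single j 1) (0, Pi.single j 1) = 0) ∧
      (∀ r, t r (0, Pi.single j 1) (0, Pi.single i 1) = t r (0, Pi.single i 1) (0, Pi.single j 1))) := by
  obtain ⟨σ, h2, h3⟩ := exists_perm_two_three i j hij
  set π := σ.symm with hπ
  have hπ2 : π.symm 2 = i := by rw [hπ, Equiv.symm_symm, h2]
  have hπ3 : π.symm 3 = j := by rw [hπ, Equiv.symm_symm, h3]
  set P := ((LinearEquiv.funCongrLeft K K π).prodCongr (LinearEquiv.funCongrLeft K K π)).toLinearMap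
    with hP
  set t' : ι → (((Fin 4 → K) × (Fin 4 → K)) →ₗ[K] ((Fin 4 → K) × (Fin 4 → K)) →ₗ[K] K) :=
    fun r => (t r).compl₁₂ P P with ht'
  have hev : ∀ r (a b v w : Fin 4 → K), t' r (a, b) (v, w) = t r (a ∘ π, b ∘ π) (v ∘ π, w ∘ π) :=
    fun r a b v w => rfl
  have hJ' : ∀ a b y₂ y₃ : Fin 4 → K,
      ∑ r, c r * (t' r (a, b) (y₂, y₃)) ^ 2 = (Matrix.of ![a, b, y₂, y₃]).permanent :=
    hJ_perm c t hJ π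
  have e2 : ((Pi.single 2 (1 : K) : Fin 4 → K) ∘ π) = Pi.single i 1 := by
    rw [single_comp_perm, hπ2]
  have e3 : ((Pi.single 3 (1 : K) : Fin 4 → K) ∘ π) = Pi.single j 1 := by
    rw [single_comp_perm, hπ3]
  have z0 : ((0 : Fin 4 → K) ∘ π) = 0 := rfl
  -- any `a'` is of the form `a ∘ π`
  have hsurj : ∀ a' : Fin 4 → K, (a' ∘ π.symm) ∘ π = a' := fun a' => by
    funext q; simp
  rcases family₂₃ hι c hc t' hJ' with hA | hB
  · left
    obtain ⟨h1, h2', h3', h4, h5⟩ := columns_of_caseA t' hA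
    simp only [hev, e2, e3, z0] at h1 h2' h3' h4 h5
    exact ⟨fun a r => by simpa [hsurj] using h1 (a ∘ π.symm) r,
      fun a r => by simpa [hsurj] using h2' (a ∘ π.symm) r, h3', h4, h5⟩
  · right
    obtain ⟨h1, h2', h3', h4, h5⟩ := columns_of_caseB t' hB
    simp only [hev, e2, e3, z0] at h1 h2' h3' h4 h5
    exact ⟨fun a r => by simpa [hsurj] using h1 (a ∘ π.symm) r,
      fun a r => by simpa [hsurj] using h2' (a ∘ π.symm) r, h3', h4, h5⟩

/-- **Every column pair, base family `a ∈ span(e_c, e_d)`** (the row-swapped `family_pair`):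
either the `b`-parts of the columns `c, d` of the `y₂`-block vanish, or those of the
`y₃`-block. [folklore] -/
theorem family_pair' [CharZero K] [DecidableEq ι] (hι : Fintype.card ι ≤ 9) (c : ι → K)
    (hc : ∀ r, c r ≠ 0)
    (t : ι → (((Fin 4 → K) × (Fin 4 → K)) →ₗ[K] ((Fin 4 → K) × (Fin 4 → K)) →ₗ[K] K))
    (hJ : ∀ a b y₂ y₃ : Fin 4 → K,
      ∑ r, c r * (t r (a, b) (y₂, y₃)) ^ 2 = (Matrix.of ![a, b, y₂, y₃]).permanent)
    (i j : Fin 4) (hij : i ≠ j) :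
    ((∀ (b : Fin 4 → K) r, t r (0, b) (Pi.single i 1, 0) = 0) ∧
      (∀ (b : Fin 4 → K) r, t r (0, b) (Pi.single j 1, 0) = 0)) ∨
    ((∀ (b : Fin 4 → K) r, t r (0, b) (0, Pi.single i 1) = 0) ∧
      (∀ (b : Fin 4 → K) r, t r (0, b) (0, Pi.single j 1) = 0)) := by
  set t' : ι → (((Fin 4 → K) × (Fin 4 → K)) →ₗ[K] ((Fin 4 → K) × (Fin 4 → K)) →ₗ[K] K) :=
    fun r => (t r).compl₁₂ (LinearEquiv.prodComm K (Fin 4 → K) (Fin 4 → K)).toLinearMap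
      LinearMap.id with ht'
  have hev : ∀ r (a b : Fin 4 → K) (y : (Fin 4 → K) × (Fin 4 → K)), t' r (a, b) y = t r (b, a) y :=
    fun r a b y => rfl
  rcases family_pair hι c hc t' (hJ_swap c t hJ) i j hij with ⟨h1, h2, -⟩ | ⟨h1, h2, -⟩
  · left
    simp only [hev] at h1 h2
    exact ⟨h1, h2⟩
  · right
    simp only [hev] at h1 h2
    exact ⟨h1, h2⟩

/-! ### Column types -/

/-- **All columns have type `X`, or all have type `Y`.**  Type `X` of a column `k`: the
`a`-part of column `k` of the `y₂`-block and the `b`-part of column `k` of the `y₃`-block vanish;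
type `Y`: the mirror statement. [folklore] -/
theorem allX_or_allY [CharZero K] [DecidableEq ι] (hι : Fintype.card ι ≤ 9) (c : ι → K)
    (hc : ∀ r, c r ≠ 0)
    (t : ι → (((Fin 4 → K) × (Fin 4 → K)) →ₗ[K] ((Fin 4 → K) × (Fin 4 → K)) →ₗ[K] K))
    (hJ : ∀ a b y₂ y₃ : Fin 4 → K,
      ∑ r, c r * (t r (a, b) (y₂, y₃)) ^ 2 = (Matrix.of ![a, b, y₂, y₃]).permanent) :
    (∀ k : Fin 4, (∀ (a : Fin 4 → K) r, t r (a, 0) (Pi.single k 1, 0) = 0) ∧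
        (∀ (b : Fin 4 → K) r, t r (0, b) (0, Pi.single k 1) = 0)) ∨
    (∀ k : Fin 4, (∀ (a : Fin 4 → K) r, t r (a, 0) (0, Pi.single k 1) = 0) ∧
        (∀ (b : Fin 4 → K) r, t r (0, b) (Pi.single k 1, 0) = 0)) := by
  have hsplit : ∀ (a b : Fin 4 → K) (y : (Fin 4 → K) × (Fin 4 → K)) r,
      t r (a, b) y = t r (a, 0) y + t r (0, b) y := fun a b y r => by
    rw [← LinearMap.add_apply, ← map_add]; simp
  -- a column cannot have both parts zero
  have excl₂ : ∀ k : Fin 4, (∀ (a : Fin 4 → K) r, t r (a, 0) (Pi.single k 1, 0) = 0) →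
      (∀ (b : Fin 4 → K) r, t r (0, b) (Pi.single k 1, 0) = 0) → False := fun k ha hb => by
    have h := eq_zero_of_forall_left c t hJ (Pi.single k 1) fun a b r => by
      rw [hsplit, ha, hb, add_zero]
    simpa using congr_fun h k
  have excl₃ : ∀ k : Fin 4, (∀ (a : Fin 4 → K) r, t r (a, 0) (0, Pi.single k 1) = 0) →
      (∀ (b : Fin 4 → K) r, t r (0, b) (0, Pi.single k 1) = 0) → False := fun k ha hb => by
    have h := eq_zero_of_forall_right c t hJ (Pi.single k 1) fun a b r => by
      rw [hsplit, ha, hb, add_zero]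
    simpa using congr_fun h k
  -- the type of a pair
  have pair : ∀ i j : Fin 4, i ≠ j →
      (((∀ (a : Fin 4 → K) r, t r (a, 0) (Pi.single i 1, 0) = 0) ∧
        (∀ (b : Fin 4 → K) r, t r (0, b) (0, Pi.single i 1) = 0)) ∧
       ((∀ (a : Fin 4 → K) r, t r (a, 0) (Pi.single j 1, 0) = 0) ∧
        (∀ (b : Fin 4 → K) r, t r (0, b) (0, Pi.single j 1) = 0))) ∨
      (((∀ (a : Fin 4 → K) r, t r (a, 0) (0, Pi.single i 1) = 0) ∧
        (∀ (b : Fin 4 → K) r, t r (0, b) (Pi.single i 1, 0) = 0)) ∧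
       ((∀ (a : Fin 4 → K) r, t r (a, 0) (0, Pi.single j 1) = 0) ∧
        (∀ (b : Fin 4 → K) r, t r (0, b) (Pi.single j 1, 0) = 0))) := by
    intro i j hij
    rcases family_pair hι c hc t hJ i j hij with ⟨hAi, hAj, -⟩ | ⟨hBi, hBj, -⟩ <;>
      rcases family_pair' hι c hc t hJ i j hij with ⟨hA'i, hA'j⟩ | ⟨hB'i, hB'j⟩
    · exact (excl₂ i hAi hA'i).elim
    · exact Or.inl ⟨⟨hAi, hB'i⟩, ⟨hAj, hB'j⟩⟩
    · exact Or.inr ⟨⟨hBi, hA'i⟩, ⟨hBj, hA'j⟩⟩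
    · exact (excl₃ i hBi hB'i).elim
  have hcases : ∀ k : Fin 4, k = 0 ∨ k = 1 ∨ k = 2 ∨ k = 3 := by decide
  rcases pair 0 1 (by decide) with ⟨hX0, hX1⟩ | ⟨hY0, hY1⟩
  · left
    have hX2 := (pair 0 2 (by decide)).resolve_right fun h => excl₂ 0 hX0.1 h.1.2
    have hX3 := (pair 0 3 (by decide)).resolve_right fun h => excl₂ 0 hX0.1 h.1.2
    intro k
    rcases hcases k with rfl | rfl | rfl | rfl
    exacts [hX0, hX1, hX2.2, hX3.2]
  · right
    have hY2 := (pair 0 2 (by decide)).resolve_left fun h => excl₂ 0 h.1.1 hY0.2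
    have hY3 := (pair 0 3 (by decide)).resolve_left fun h => excl₂ 0 h.1.1 hY0.2
    intro k
    rcases hcases k with rfl | rfl | rfl | rfl
    exacts [hY0, hY1, hY2.2, hY3.2]


end Summit.ValiantsHypothesis.ValiantsHypothesis.Theorems.SymPencilPerFourInnerRankTenPairs

end
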